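import Literature.MathematicalPhysics.QuantumFieldTheory.Balaban1983to89.B8Prop5LandauDataZd
import Literature.MathematicalPhysics.QuantumFieldTheory.Balaban1983to89.T4TermwiseTorus

/-!
# `Balaban1983to89.B8Prop5LandauDataZdPer` — [Balaban1985RegularSpaces] Proposition 5 (p. 94) AT PERIODIC OBJECTS: the `P`-PERIODIC
# SUB-MODEL `zdLanPer` of lit-balaban's general-background `ℤᵈ × 𝔸` member `B8Prop5LandauDataZd.zdLan` — the `B8.LandauData` carrier the
# κ-periodic witness slot's own Proposition-5 conjuncts `B8.Prop5Exists B₀′ B₁ lan` ∕ `B8.Prop5Unique lan` are to be pinned to (print's torus `T_η`)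

statement-level skeleton of published theorems with citation tags; proofs where landed; nothing here is a claim about the Yang–Mills mass gap

T. Bałaban, *Spaces of regular gauge field configurations on a lattice and gauge fixing conditions*, Commun. Math. Phys. **99** (1985) 75–102
`[Balaban1985RegularSpaces]` ("B8"; journal page = PDF page + 74): Prop. 5 (1.107)–(1.109) p. 94 («for U₀ ∈ 𝔄_k({Ω_j}, α₀)», on the torus `T_η`),
(1.68)–(1.69) p. 88, (1.73)–(1.74) pp. 88–89, (1.102) p. 93, (1.29) p. 81, (1.38) p. 82, p. 77 («Ω₀ ⊃ Ω₁ ⊃ … we admit the case when some domains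
Ω_j are equal to T_η»).  `[Balaban1985Averaging]` (4) p. 18 (the torus `T_η = ηℤᵈ ∕ periods` — periodic data on `ηℤᵈ`).
PDF held: `paper:balaban1985-cmp99-regular-spaces-gauge-fixing` pp. 88–89 [PDF 14–15], 93–95 [PDF 19–21].

CITATION HEADER (lean-in-tree rule).  Cell `pub-ymgap` (HUMAN RULING D-0062, Track A), DAG node N05 = [B8], seat `pub-ymgap-dag-n05-c` (g17; the member-model lineage:
P1 `B8LeafModelZdPer.zdGF3Per`, P1′ `B8LeafModelZdHP2Per.zdGF3HP₂Per`).  Plan g87 row (R0) «YMPLAN-G87-N05-LOCATED4 — GO NOW» (pub-ymgap bus 2026-08-28T17:20:51Z) under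
director-ym №227 (b) «GUARDED REQUIRED» (17:15:46Z) read on the slot's own Prop-5 conjuncts (this seat's LOCATED-4, 17:19Z).

WHY THIS FILE.  The κ-periodic witness slot of record (`B8LeafOfRecordSubBP₂DPerκ`, A-5′) carries Proposition 5 as the conjuncts `p5e ∕ p5u` =
`B8.Prop5Exists B₀′ B₁ lan` ∕ `B8.Prop5Unique lan` over a pinned family `lan`.  Pinned to `zdLan θ.L B₁ a.toZdLanIdx` (`Node00/CarriersB8SubBPCutP5`), those members are
Proposition 5 ON `ℤᵈ` — configurations `(u₁, A)` on all of `ℤᵈ`, parameters `λ` supported in `Ω₀ = ℤᵈ`, an arbitrary unitary background — i.e. «[B8] Prop 5 in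
infinite volume», which print (p. 94, on `T_η`) does not serve.  THIS FILE is the periodic member the pin is re-keyed on: `zdLanPer L B₁ i P` = `zdLan L B₁ i` read on
`P`-PERIODIC data — the datum `(u₁, A)` and the gauge parameter `λ` range over the `P`-periodic sub-carriers (print's `T_η` as `P`-periodic data on `ηℤᵈ`,
[Balaban1985Averaging] (4)), every predicate ∕ norm is `zdLan`'s body at the underlying fields (the P1 `zdGF3Per` pattern).  At a periodic index member
(periodic `Ω_j`, periodic `U₀` — the INDEX's laws, not this file's) `B8.Prop5Exists ∕ Prop5Unique (zdLanPer …)` is a statement of print's shape: a solution `λ` is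
sought AMONG PERIODIC parameters and uniqueness is asked AMONG PERIODIC competitors.

WHAT THIS FILE PROVIDES (one `def`, bookkeeping lemmas; no estimate).
§1 `zdLanPer L B₁ i P : B8.LandauData` — `Cfg := {p : (zdLan L B₁ i).Cfg // IsPeriodic P u₁ ∧ IsPeriodic P A}`, `Lam := {λ : (zdLan L B₁ i).Lam // IsPeriodic P λ}`,
   `Hyp169 ∕ lamNorm ∕ Solves` := `zdLan`'s on `.1`.
§2 faces (`rfl` ∕ `Iff.rfl`): `hyp169_iff`, `solves_iff`, `lamNorm_eq`, the projections `cfgZdL ∕ lamZdL` and the periodicity accessors.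
§3 non-vacuity (constants are periodic, `B8LeafModelZdPer.isPeriodic_const`'s one-liner inlined): `lamZeroPer` (the zero parameter, periodic), `lamNorm_lamZeroPer`, `solves_lamZeroPer_iff`, `nonempty_cfg ∕ nonempty_lam`.
§4 the ONE valid pure-∀ transfer: `prop5Unique_per_of_zd` — uniqueness among all parameters on `ℤᵈ` restricts to uniqueness among periodic ones, along any index ∕
   period maps.  (Existence does NOT transfer this way — a `ℤᵈ` solution need not be periodic — and no such lemma is stated: under №227 (b) the periodic
   `Prop5Exists` is to be SERVED by a torus Proposition 5, not derived from the `ℤᵈ` one.)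

HONEST SCOPE.  A DEFINITION file with bookkeeping lemmas; nothing of [Balaban1985RegularSpaces]'s estimates proved; Proposition 5 itself (either half) is NOT proved
here; count-neutral; N05 NOT discharged; one finite `T⁴` programme at fixed `ε`; nothing continuum ∕ ℝ⁴ ∕ OS ∕ mass-gap ∕ Clay.  Unit `pub-ymgap-dag-n05-c` (g17),
2026-08-28.  No `sorry`, no `axiom`, no `instance`, no `notation`.
-/

noncomputable section

open NormedSpace

namespace Literature.MathematicalPhysics.QuantumFieldTheory.Balaban1983to89.B8Prop5LandauDataZdPer

open B7Prop1Explicit B7Prop2Explicit B7Eq92Concrete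
open B8Ineq132 (covDerivFwd InAk)
open B8Eq119TwistedAxial (Restr129)
open B8Eq184Proof (gaugeExp cfgExp)
open B8Eq138LandauZd (IsLandau138W)
open B8Eq178Averages (Cond168 Cond169)
open B8ScaledSupNorm (siteNorm bondNorm)
open B8Prop5LandauDataZd (ZdLanIdx zdLan Cond7374 lamZero lamZero_val zdLan_solves_iff zdLan_lamNorm_eq lamNorm_lamZero solves_lamZero_iff)
open T4TermwiseTorus (IsPeriodic)

-- `Site` alone could resolve to the torus sites of `Setup.lean`; re-export the `ℤ^d` sites of `B7Prop1Explicit`.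
export B7Prop1Explicit (Site)

variable {d : ℕ}

/-! ## §1 The member: `zdLan` read on `P`-periodic data -/

section Member

variable {𝔸 : Type} [CStarAlgebra 𝔸]

/-- **The `P`-periodic sub-model of Proposition 5's `ℤᵈ × 𝔸` datum `zdLan L B₁ i`** as a `B8.LandauData`: the data `(u₁, U₁ = e^{iηA})` with `u₁` AND `A`
`P`-periodic, the gauge parameters `λ` of `u′ = e^{iλ}` `P`-periodic (print's `T_η` read as `P`-periodic data on `ηℤᵈ`); the hypothesis (1.33) ∧ (1.69) ∧ (1.68) ∧
(1.73)–(1.74), the norm `max(|λ|, |Dλ|₍₋₁₎)` of (1.102) ∕ (1.108) and the equations (1.107) are `zdLan`'s, read at the underlying fields.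
[cite: Balaban1985RegularSpaces, Prop. 5 (1.107)–(1.109) p.94, (1.68)–(1.69) p.88, (1.73)–(1.74) pp.88–89, (1.102) p.93, p.77 («Ω_j ⊂ T_η»); Balaban1985Averaging, (4) p.18] -/
def zdLanPer (L : ℕ) (B₁ : ℝ) (i : ZdLanIdx d 𝔸) (P : ℕ) : B8.LandauData where
  Cfg := {p : (zdLan L B₁ i).Cfg // IsPeriodic P p.1.1 ∧ IsPeriodic P p.1.2}
  Lam := {lam : (zdLan L B₁ i).Lam // IsPeriodic P lam.1}
  Hyp169 := fun α₀ α₁ p => (zdLan L B₁ i).Hyp169 α₀ α₁ p.1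
  lamNorm := fun lam => (zdLan L B₁ i).lamNorm lam.1
  Solves := fun p lam => (zdLan L B₁ i).Solves p.1 lam.1

end Member

/-! ## §2 Faces: the projections onto `zdLan`'s carriers, the fields read at the underlying data, the periodicity accessors -/

section Faces

variable {𝔸 : Type} [CStarAlgebra 𝔸] {L : ℕ} {B₁ : ℝ} {i : ZdLanIdx d 𝔸} {P : ℕ}

/-- The underlying `ℤᵈ` datum `(u₁, A)` of a periodic datum (forget periodicity). [cite: Balaban1985RegularSpaces, p.77 («Ω_j ⊂ T_η»), (1.68)–(1.69) p.88 (bookkeeping)] -/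
def cfgZdL (p : (zdLanPer L B₁ i P).Cfg) : (zdLan L B₁ i).Cfg := p.1

/-- The underlying `ℤᵈ` gauge parameter of a periodic parameter (forget periodicity). [cite: Balaban1985RegularSpaces, p.77 («Ω_j ⊂ T_η»), (1.107) p.94 (bookkeeping)] -/
def lamZdL (lam : (zdLanPer L B₁ i P).Lam) : (zdLan L B₁ i).Lam := lam.1

/-- [cite: Balaban1985RegularSpaces, p.77 (bookkeeping)] -/
@[simp] theorem cfgZdL_eq (p : (zdLanPer L B₁ i P).Cfg) : cfgZdL p = p.1 := rfl

/-- [cite: Balaban1985RegularSpaces, p.77 (bookkeeping)] -/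
@[simp] theorem lamZdL_eq (lam : (zdLanPer L B₁ i P).Lam) : lamZdL lam = lam.1 := rfl

/-- The datum's gauge transformation `u₁` is `P`-periodic. [cite: Balaban1985RegularSpaces, p.77 («Ω_j ⊂ T_η»), (1.68) p.88] -/
theorem cfg_isPeriodic_u (p : (zdLanPer L B₁ i P).Cfg) : IsPeriodic P p.1.1.1 := p.2.1

/-- The datum's exponent `A` (`U₁ = e^{iηA}`) is `P`-periodic. [cite: Balaban1985RegularSpaces, p.77 («Ω_j ⊂ T_η»), (1.69) p.88] -/
theorem cfg_isPeriodic_A (p : (zdLanPer L B₁ i P).Cfg) : IsPeriodic P p.1.1.2 := p.2.2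

/-- The gauge parameter `λ` is `P`-periodic. [cite: Balaban1985RegularSpaces, p.77 («Ω_j ⊂ T_η»), (1.107) p.94] -/
theorem lam_isPeriodic (lam : (zdLanPer L B₁ i P).Lam) : IsPeriodic P lam.1.1 := lam.2

variable (L B₁ i P)

/-- The hypothesis field IS `zdLan`'s at the underlying datum (`Iff.rfl`): (1.33) ∧ (1.69) ∧ (1.68) ∧ (1.73)–(1.74).
[cite: Balaban1985RegularSpaces, (1.68)–(1.69) p.88, (1.73)–(1.74) pp.88–89, (1.33) p.82] -/
theorem hyp169_iff (α₀ α₁ : ℝ) (p : (zdLanPer L B₁ i P).Cfg) :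
    (zdLanPer L B₁ i P).Hyp169 α₀ α₁ p ↔
      InAk L i.k i.η α₀ i.Ω i.U₀ ∧ Cond169 L i.k i.η i.Ω i.U₀ p.1.1.2 (B₁ * (α₀ + α₁)) ∧
        Cond168 L (i.k - 1) i.Λ i.U₀ p.1.1.1 ∧
          Cond7374 L i.k i.Λ i.U₀ p.1.1.1 (16 * d * B₁ * (α₀ + α₁)) (4 * d * B₁ * (α₀ + α₁)) :=
  Iff.rfl

/-- The hypothesis field at a periodic datum is LITERALLY `zdLan`'s at its underlying datum (`Iff.rfl`). [cite: Balaban1985RegularSpaces, (1.68)–(1.69) p.88 (bookkeeping)] -/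
theorem hyp169_iff_zd (α₀ α₁ : ℝ) (p : (zdLanPer L B₁ i P).Cfg) :
    (zdLanPer L B₁ i P).Hyp169 α₀ α₁ p ↔ (zdLan L B₁ i).Hyp169 α₀ α₁ p.1 :=
  Iff.rfl

/-- The equations (1.107) at a periodic datum and a periodic parameter ARE `zdLan`'s at the underlying fields (`Iff.rfl`): the Landau condition (1.38) for
`U₁^{u′⁻¹}` and the restrictions (1.29) for `u′u₁`. [cite: Balaban1985RegularSpaces, (1.107) p.94, (1.38) p.82, (1.29) p.81] -/
theorem solves_iff (p : (zdLanPer L B₁ i P).Cfg) (lam : (zdLanPer L B₁ i P).Lam) :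
    (zdLanPer L B₁ i P).Solves p lam ↔
      IsLandau138W L i.k i.η (i.Ω 0) i.Λ i.U₀ (mgauge i.U₀ (gaugeExp lam.1.1)⁻¹ (cfgExp i.η p.1.1.2)) ∧
        Restr129 L i.k i.Λ i.U₀ (p.1.1.1 * gaugeExp lam.1.1) :=
  Iff.rfl

/-- `Solves` at periodic arguments is LITERALLY `zdLan`'s (`Iff.rfl`). [cite: Balaban1985RegularSpaces, (1.107) p.94 (bookkeeping)] -/
theorem solves_iff_zd (p : (zdLanPer L B₁ i P).Cfg) (lam : (zdLanPer L B₁ i P).Lam) :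
    (zdLanPer L B₁ i P).Solves p lam ↔ (zdLan L B₁ i).Solves p.1 lam.1 :=
  Iff.rfl

/-- The norm field IS `zdLan`'s (`rfl`): `max(|λ|, |D_{U₀}λ|₍₋₁₎)` over `Ω_j`, `j ≦ k − 1`. [cite: Balaban1985RegularSpaces, (1.102) p.93, (1.108) p.94] -/
theorem lamNorm_eq (lam : (zdLanPer L B₁ i P).Lam) :
    (zdLanPer L B₁ i P).lamNorm lam =
      max (siteNorm L (i.k - 1) i.η 0 i.Ω lam.1.1)
        (bondNorm L (i.k - 1) i.η (-1) i.Ω (fun x μ => covDerivFwd i.η i.U₀ μ lam.1.1 x)) :=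
  rfl

/-- The norm at a periodic parameter is LITERALLY `zdLan`'s at its underlying parameter (`rfl`). [cite: Balaban1985RegularSpaces, (1.108) p.94 (bookkeeping)] -/
theorem lamNorm_eq_zd (lam : (zdLanPer L B₁ i P).Lam) : (zdLanPer L B₁ i P).lamNorm lam = (zdLan L B₁ i).lamNorm lam.1 := rfl

end Faces

/-! ## §3 Non-vacuity: the zero parameter is periodic; the constant datum `(1, 0)` is periodic -/

section NonVacuity

variable {𝔸 : Type} [CStarAlgebra 𝔸] (L : ℕ) (B₁ : ℝ) (i : ZdLanIdx d 𝔸) (P : ℕ)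

/-- **The zero gauge parameter as a PERIODIC parameter** (`λ = 0`, `u′ = 1`; p. 95 «a configuration identically equal to 1 is a solution also»).
[cite: Balaban1985RegularSpaces, p.95 (proof of the uniqueness clause of Thm 4)] -/
def lamZeroPer : (zdLanPer L B₁ i P).Lam :=
  ⟨lamZero L B₁ i, by rw [lamZero_val]; exact fun _ _ => rfl⟩

/-- [cite: Balaban1985RegularSpaces, p.95 (bookkeeping)] -/
@[simp] theorem lamZeroPer_val : (lamZeroPer L B₁ i P).1 = lamZero L B₁ i := rfl

/-- The periodic zero parameter has norm `0`. [cite: Balaban1985RegularSpaces, (1.108) p.94, p.86] -/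
theorem lamNorm_lamZeroPer : (zdLanPer L B₁ i P).lamNorm (lamZeroPer L B₁ i P) = 0 :=
  lamNorm_lamZero L B₁ i

/-- The periodic zero parameter solves (1.107) for a periodic datum `(u₁, U₁ = e^{iηA})` iff `U₁` itself obeys (1.38) and `u₁` itself obeys (1.29)_k
(lit-balaban's `solves_lamZero_iff` at the underlying datum). [cite: Balaban1985RegularSpaces, p.95, (1.107) p.94] -/
theorem solves_lamZeroPer_iff (p : (zdLanPer L B₁ i P).Cfg) :
    (zdLanPer L B₁ i P).Solves p (lamZeroPer L B₁ i P) ↔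
      IsLandau138W L i.k i.η (i.Ω 0) i.Λ i.U₀ (cfgExp i.η p.1.1.2) ∧ Restr129 L i.k i.Λ i.U₀ p.1.1.1 :=
  solves_lamZero_iff L B₁ i p.1

/-- The periodic parameters are inhabited (by `λ = 0`). [cite: Balaban1985RegularSpaces, p.95 (bookkeeping)] -/
theorem nonempty_lam : Nonempty (zdLanPer L B₁ i P).Lam := ⟨lamZeroPer L B₁ i P⟩

/-- The periodic data are inhabited: `(u₁, A) := (1, 0)` is unitary, Hermitian and `P`-periodic. [cite: Balaban1985RegularSpaces, p.89 («if we take u₁ = 1»), (1.69) p.88 (bookkeeping)] -/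
theorem nonempty_cfg : Nonempty (zdLanPer L B₁ i P).Cfg :=
  ⟨⟨⟨((1 : Site d → 𝔸ˣ), (0 : Site d → Fin d → 𝔸)), fun _ => Subgroup.one_mem _, fun _ _ => by simp⟩,
    fun _ _ => rfl, fun _ _ => rfl⟩⟩

end NonVacuity

/-! ## §4 The one valid pure-∀ transfer: uniqueness on `ℤᵈ` restricts to uniqueness among periodic parameters -/

section Transfer

variable {𝔸 : Type} [CStarAlgebra 𝔸] (L : ℕ) (B₁ : ℝ)

/-- **UNIQUENESS TRANSFERS FROM `ℤᵈ` TO PERIODIC DATA (pure restriction of universal quantifiers)**: along any index map `ι : J → ZdLanIdx` and any period map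
`p : J → ℕ`, Proposition 5's uniqueness clause (1.109) for the `ℤᵈ` members `zdLan L B₁ (ι a)` implies it for the periodic members `zdLanPer L B₁ (ι a) (p a)`
(same constants `c₂, c₃`): two periodic solutions in the `c₃`-domain are two solutions there, hence equal as `ℤᵈ` parameters, hence equal.  HONEST LABEL: this
consumes the `ℤᵈ` (infinite-volume) uniqueness — a BANKED input under director-ym №227 (b); the converse direction and the EXISTENCE half do NOT transfer
(a `ℤᵈ` solution need not be periodic) and are not stated. [cite: Balaban1985RegularSpaces, Prop. 5 (1.109) p.94, p.77 («Ω_j ⊂ T_η»)] -/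
theorem prop5Unique_per_of_zd {J : Type} (ι : J → ZdLanIdx d 𝔸) (p : J → ℕ)
    (h : B8.Prop5Unique (fun a : J => zdLan L B₁ (ι a))) :
    B8.Prop5Unique (fun a : J => zdLanPer L B₁ (ι a) (p a)) := by
  obtain ⟨c₂, c₃, hc₂, hc₃, H⟩ := h
  refine ⟨c₂, c₃, hc₂, hc₃, fun a α₀ α₁ hα₀ hα₁ hs U₁ hU l₁ l₂ h₁ h₂ hn₁ hn₂ => ?_⟩
  exact Subtype.ext (H a α₀ α₁ hα₀ hα₁ hs U₁.1 hU l₁.1 l₂.1 h₁ h₂ hn₁ hn₂)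

/-- The same along the identity: `Prop5Unique (zdLan L B₁ ·) → Prop5Unique (fun i => zdLanPer L B₁ i P)` at one period `P` for the whole `ZdLanIdx` family.
[cite: Balaban1985RegularSpaces, Prop. 5 (1.109) p.94 (bookkeeping)] -/
theorem prop5Unique_per_of_zd_id (P : ℕ) (h : B8.Prop5Unique (fun i : ZdLanIdx d 𝔸 => zdLan L B₁ i)) :
    B8.Prop5Unique (fun i : ZdLanIdx d 𝔸 => zdLanPer L B₁ i P) :=
  prop5Unique_per_of_zd L B₁ id (fun _ => P) h

end Transfer

#print axioms prop5Unique_per_of_zd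

end Literature.MathematicalPhysics.QuantumFieldTheory.Balaban1983to89.B8Prop5LandauDataZdPer

end
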